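import Summits.SmoothPoincare4.SmoothPoincare4.Theorems.SymplecticOrigamiGromovRecognitionRelEndStubPositiveHolonomyAux2
import Literature.Geometry.Symplectic.AlmostComplexStructure

/-!
# Positive holonomy for `GromovRecognitionRelEnd` — the holonomy sign at a point
(stub `stub_positiveHolonomy` of line `cross-cap-laurent`, crux `SymplecticOrigami.GromovRecognitionRelEnd`,
item stmt-SmoothPoincare4-11009; third auxiliary file)

For a `C^∞` map `λ : X → X` into `H∞` with `J`-invariant kernels of `dλ`, read in a flat chart
`λ = η ∘ ℓ` near `y` (second auxiliary file):

* `exists_pos_iff_ar01_pos` — **the bridge**: for `dλ v ≠ 0`, the orientation clause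
  `dλ (J v) = α dλ v + β J (dλ v)` with `β > 0` holds iff the holonomy form
  `D(v) = dx₀∧dx₁ (dℓ v, dℓ (J v))` is positive (the clause always holds with
  `β = D(v) / |dℓ v|²`, and the coefficients are unique);
* `pos_iff_ar01_pos` — hence the clause holds for ALL `v` off the kernel iff `D(v₀) > 0` for ONE;
* `exists_mfderiv_ne_zero` — `dλ_y ≠ 0` at every point, from a flat chart of the second retraction
  `λ'` (its kernel is non-trivial, `dim = 2 < 4`) and transversality `ker dλ ∩ ker dλ' = 0`;
* `pos_at_axis` — at the axis point `η 0` of a chart in which `λ` restricts to the identity of the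
  axis, `dλ = id` on `T H∞` and the clause holds with `α = 0`, `β = 1`.
-/

noncomputable section

-- the registered namespace `Summit.SmoothPoincare4.SmoothPoincare4.Theorems…` repeats a component
set_option linter.dupNamespace false

open scoped Manifold ContDiff Topology
open Set Function Filter Literature.Geometry.Symplectic

namespace Summit.SmoothPoincare4.SmoothPoincare4.Theorems.GromovRecognitionRelEnd.CrossCapLaurent

namespace PosHolonomy

open CapModel FlatLeaves

variable {X : Type*} [TopologicalSpace X] [ChartedSpace (EuclideanSpace ℝ (Fin 4)) X]
  [IsManifold (𝓡 4) ∞ X] (JX : AlmostComplexStructure (𝓡 4) ∞ X)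
  {lam : X → X} {η : EuclideanSpace ℝ (Fin 4) → X} {D : Set (EuclideanSpace ℝ (Fin 4))} {N : Set X}
  (hlam : ContMDiff (𝓡 4) (𝓡 4) ∞ lam)
  (hD : IsOpen D) (hη : IsLocalDiffeomorphOn 𝓘(ℝ, EuclideanSpace ℝ (Fin 4)) (𝓡 4) ∞ η D)
  (hinj : InjOn η D)
  (hhol : ∀ p ∈ D, ∀ q : EuclideanSpace ℝ (Fin 4),
    JX (η p) (mfderiv 𝓘(ℝ, EuclideanSpace ℝ (Fin 4)) (𝓡 4) η p q) =
      mfderiv 𝓘(ℝ, EuclideanSpace ℝ (Fin 4)) (𝓡 4) η p (I4 q))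
  (hN : IsOpen N) (hflat : ∀ y ∈ N, ∃ p ∈ D, p 2 = 0 ∧ p 3 = 0 ∧ η p = lam y)

/-! ## The bridge: orientation clause versus the holonomy form -/

include hlam hD hη hinj hhol hN hflat in
/-- **The bridge.** In a flat chart at `y`, for `dℓ v ≠ 0` and any `w` (`= J v` in the sequel):
the orientation clause `∃ α β, 0 < β ∧ dλ w = α dλ v + β J (dλ v)` holds iff
`dx₀∧dx₁ (dℓ v, dℓ w) > 0`.  Indeed `dℓ w = α₀ dℓ v + β₀ I4 (dℓ v)` in the axis plane with
`β₀ = dx₀∧dx₁ (dℓ v, dℓ w) / |dℓ v|²` (`plane_decomp`); applying the holomorphic `dη` gives the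
clause with `(α₀, β₀)`, and the coefficients on `(dλ v, J dλ v)` are unique. [folklore] -/
theorem exists_pos_iff_ar01_pos {y : X} (hy : y ∈ N)
    {Lam L Jh : EuclideanSpace ℝ (Fin 4) →L[ℝ] EuclideanSpace ℝ (Fin 4)}
    (hLam : Lam = mfderiv (𝓡 4) (𝓡 4) lam y)
    (hL : L = mfderiv (𝓡 4) 𝓘(ℝ, EuclideanSpace ℝ (Fin 4)) (invFunOn η D ∘ lam) y)
    (hJh : Jh = JX (lam y)) {v : EuclideanSpace ℝ (Fin 4)} (hv : L v ≠ 0)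
    (w : EuclideanSpace ℝ (Fin 4)) :
    (∃ α β : ℝ, 0 < β ∧ Lam w = α • Lam v + β • Jh (Lam v)) ↔ 0 < ar01 (L v) (L w) := by
  obtain ⟨Φ, hΦ⟩ : ∃ Φ : EuclideanSpace ℝ (Fin 4) →L[ℝ] EuclideanSpace ℝ (Fin 4),
      Φ = mfderiv 𝓘(ℝ, EuclideanSpace ℝ (Fin 4)) (𝓡 4) η ((invFunOn η D ∘ lam) y) := ⟨_, rfl⟩
  have hcomp : Lam = Φ.comp L := mfderiv_eq_comp_invChart hD hη hinj hflat hlam hN hy hLam hΦ hL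
  have hpl : ∀ w, L w 2 = 0 ∧ L w 3 = 0 := mfderiv_invChart_plane hD hη hinj hflat hlam hN hy hL
  have hholy : ∀ q, Jh (Φ q) = Φ (I4 q) := hol_at_invChart hinj hflat hhol hy hΦ hJh
  have hJJ : ∀ w, Jh (Jh w) = -w := by
    subst hJh
    exact fun w => JX.map_map (lam y) w
  have hLamv : Lam v ≠ 0 := fun h =>
    hv ((mfderiv_eq_zero_iff_invChart hD hη hinj hflat hlam hN hy hLam hL v).1 h)
  have hr : 0 < r1 (L v) :=
    lt_of_le_of_ne (r1_nonneg _) (Ne.symm (r1_ne_zero_of_plane (hpl v).1 (hpl v).2 hv))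
  -- the clause with the explicit coefficients
  set α₀ : ℝ := (L v 0 * L w 0 + L v 1 * L w 1) / r1 (L v) with hα₀
  set β₀ : ℝ := ar01 (L v) (L w) / r1 (L v) with hβ₀
  have hdec := plane_decomp (hpl v).1 (hpl v).2 (hpl w).1 (hpl w).2 hv
  have hclause : Lam w = α₀ • Lam v + β₀ • Jh (Lam v) := by
    rw [hcomp, ContinuousLinearMap.comp_apply, ContinuousLinearMap.comp_apply, hdec, map_add,
      map_smul, map_smul, hholy]
  constructor
  · rintro ⟨α, β, hβ, h⟩
    rw [hclause] at h
    have hu := coeff_unique Jh.toLinearMap (fun w => hJJ w) hLamv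
      (show α₀ • Lam v + β₀ • Jh.toLinearMap (Lam v) = α • Lam v + β • Jh.toLinearMap (Lam v) from h)
    rw [← hu.2, hβ₀] at hβ
    exact (div_pos_iff_of_pos_right hr).1 hβ
  · intro h
    exact ⟨α₀, β₀, div_pos h hr, hclause⟩

include hlam hD hη hinj hhol hN hflat in
/-- **The sign is the same for all vectors.** In a flat chart at `y` (kernel of `dλ_y`
`J`-invariant), if `dℓ v₀ ≠ 0` then: the orientation clause holds for every `v` with `dλ v ≠ 0`
iff `dx₀∧dx₁ (dℓ v₀, dℓ (J v₀)) > 0` (`ar01_pos_iff` + the bridge). [folklore] -/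
theorem pos_iff_ar01_pos {y : X} (hy : y ∈ N)
    (hJV : ∀ v : TangentSpace (𝓡 4) y, mfderiv (𝓡 4) (𝓡 4) lam y v = 0 →
      mfderiv (𝓡 4) (𝓡 4) lam y (JX y v) = 0)
    {L Jy : EuclideanSpace ℝ (Fin 4) →L[ℝ] EuclideanSpace ℝ (Fin 4)}
    (hL : L = mfderiv (𝓡 4) 𝓘(ℝ, EuclideanSpace ℝ (Fin 4)) (invFunOn η D ∘ lam) y)
    (hJy : Jy = JX y) {v₀ : EuclideanSpace ℝ (Fin 4)} (hv₀ : L v₀ ≠ 0) :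
    (∀ v : TangentSpace (𝓡 4) y, mfderiv (𝓡 4) (𝓡 4) lam y v ≠ 0 →
      ∃ α β : ℝ, 0 < β ∧ mfderiv (𝓡 4) (𝓡 4) lam y (JX y v) =
        α • mfderiv (𝓡 4) (𝓡 4) lam y v + β • JX (lam y) (mfderiv (𝓡 4) (𝓡 4) lam y v)) ↔
      0 < ar01 (L v₀) (L (Jy v₀)) := by
  obtain ⟨Lam, hLam⟩ : ∃ Lam : EuclideanSpace ℝ (Fin 4) →L[ℝ] EuclideanSpace ℝ (Fin 4),
      Lam = mfderiv (𝓡 4) (𝓡 4) lam y := ⟨_, rfl⟩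
  obtain ⟨Jh, hJh⟩ : ∃ Jh : EuclideanSpace ℝ (Fin 4) →L[ℝ] EuclideanSpace ℝ (Fin 4),
      Jh = JX (lam y) := ⟨_, rfl⟩
  have hpl : ∀ w, L w 2 = 0 ∧ L w 3 = 0 := mfderiv_invChart_plane hD hη hinj hflat hlam hN hy hL
  have hzero : ∀ w, Lam w = 0 ↔ L w = 0 :=
    mfderiv_eq_zero_iff_invChart hD hη hinj hflat hlam hN hy hLam hL
  have hJV' : ∀ w, Lam w = 0 → Lam (Jy w) = 0 := by
    subst hLam hJy
    exact hJV
  have hker : ∀ w, L w = 0 → L (Jy w) = 0 := fun w hw =>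
    (hzero _).1 (hJV' w ((hzero w).2 hw))
  have hJJ : ∀ w, Jy (Jy w) = -w := by
    subst hJy
    exact fun w => JX.map_map y w
  -- restate the left-hand side at the model type
  have hiff : (∀ v : TangentSpace (𝓡 4) y, mfderiv (𝓡 4) (𝓡 4) lam y v ≠ 0 →
      ∃ α β : ℝ, 0 < β ∧ mfderiv (𝓡 4) (𝓡 4) lam y (JX y v) =
        α • mfderiv (𝓡 4) (𝓡 4) lam y v + β • JX (lam y) (mfderiv (𝓡 4) (𝓡 4) lam y v)) ↔
      ∀ v, Lam v ≠ 0 → ∃ α β : ℝ, 0 < β ∧ Lam (Jy v) = α • Lam v + β • Jh (Lam v) := by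
    subst hLam hJy hJh
    exact Iff.rfl
  rw [hiff]
  constructor
  · intro h
    have h₀ := h v₀ (fun h0 => hv₀ ((hzero v₀).1 h0))
    exact (exists_pos_iff_ar01_pos JX hlam hD hη hinj hhol hN hflat hy hLam hL hJh hv₀ _).1 h₀
  · intro h v hv
    have hv' : L v ≠ 0 := fun h0 => hv ((hzero v).2 h0)
    rw [exists_pos_iff_ar01_pos JX hlam hD hη hinj hhol hN hflat hy hLam hL hJh hv']
    exact (ar01_pos_iff hJJ hpl hker hv₀ hv').2 h

/-! ## `dλ ≠ 0` everywhere -/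

omit [IsManifold (𝓡 4) ∞ X] in
/-- **The kernel of `dλ'` is non-trivial** in a flat chart of `λ'` (`dℓ'` is valued in a plane, so is not
injective, and `dλ' = dη' ∘ dℓ'`). [folklore] -/
theorem exists_ne_zero_mfderiv_eq_zero {lam' : X → X} {η' : EuclideanSpace ℝ (Fin 4) → X}
    {D' : Set (EuclideanSpace ℝ (Fin 4))} {N' : Set X} (hlam' : ContMDiff (𝓡 4) (𝓡 4) ∞ lam')
    (hD' : IsOpen D') (hη' : IsLocalDiffeomorphOn 𝓘(ℝ, EuclideanSpace ℝ (Fin 4)) (𝓡 4) ∞ η' D')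
    (hinj' : InjOn η' D') (hN' : IsOpen N')
    (hflat' : ∀ y ∈ N', ∃ p ∈ D', p 2 = 0 ∧ p 3 = 0 ∧ η' p = lam' y) {y : X} (hy : y ∈ N') :
    ∃ v : TangentSpace (𝓡 4) y, v ≠ 0 ∧ mfderiv (𝓡 4) (𝓡 4) lam' y v = 0 := by
  obtain ⟨Lam', hLam'⟩ : ∃ Lam' : EuclideanSpace ℝ (Fin 4) →L[ℝ] EuclideanSpace ℝ (Fin 4),
      Lam' = mfderiv (𝓡 4) (𝓡 4) lam' y := ⟨_, rfl⟩
  obtain ⟨L', hL'⟩ : ∃ L' : EuclideanSpace ℝ (Fin 4) →L[ℝ] EuclideanSpace ℝ (Fin 4),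
      L' = mfderiv (𝓡 4) 𝓘(ℝ, EuclideanSpace ℝ (Fin 4)) (invFunOn η' D' ∘ lam') y := ⟨_, rfl⟩
  have hpl : ∀ w, L' w 2 = 0 ∧ L' w 3 = 0 :=
    mfderiv_invChart_plane hD' hη' hinj' hflat' hlam' hN' hy hL'
  obtain ⟨v, hv0, hv⟩ := exists_ne_zero_map_eq_zero hpl
  have hLam'v : Lam' v = 0 :=
    (mfderiv_eq_zero_iff_invChart hD' hη' hinj' hflat' hlam' hN' hy hLam' hL' v).2 hv
  refine ⟨v, hv0, ?_⟩
  subst hLam'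
  exact hLam'v

omit [IsManifold (𝓡 4) ∞ X] in
/-- **The differential of the retraction vanishes nowhere.** If the second retraction `λ'` has a
flat chart at `y` (so `ker dλ'_y ≠ 0`: `dℓ'` is valued in a plane) and
`ker dλ_y ∩ ker dλ'_y = 0`, then `dλ_y ≠ 0`. [folklore] -/
theorem exists_mfderiv_ne_zero {lam' : X → X} {η' : EuclideanSpace ℝ (Fin 4) → X}
    {D' : Set (EuclideanSpace ℝ (Fin 4))} {N' : Set X} (hlam' : ContMDiff (𝓡 4) (𝓡 4) ∞ lam')
    (hD' : IsOpen D') (hη' : IsLocalDiffeomorphOn 𝓘(ℝ, EuclideanSpace ℝ (Fin 4)) (𝓡 4) ∞ η' D')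
    (hinj' : InjOn η' D') (hN' : IsOpen N')
    (hflat' : ∀ y ∈ N', ∃ p ∈ D', p 2 = 0 ∧ p 3 = 0 ∧ η' p = lam' y) {y : X} (hy : y ∈ N')
    (htr : ∀ v : TangentSpace (𝓡 4) y, mfderiv (𝓡 4) (𝓡 4) lam y v = 0 →
      mfderiv (𝓡 4) (𝓡 4) lam' y v = 0 → v = 0) :
    ∃ v : TangentSpace (𝓡 4) y, mfderiv (𝓡 4) (𝓡 4) lam y v ≠ 0 := by
  obtain ⟨v, hv0, hv⟩ := exists_ne_zero_mfderiv_eq_zero hlam' hD' hη' hinj' hN' hflat' hy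
  exact ⟨v, fun h => hv0 (htr v h hv)⟩

/-! ## The axis point -/

/-- `I4 = i ⊕ i` commutes with the projection `P01` onto the axis plane: `I4 ∘ P01 = P01 ∘ I4`.
[folklore] -/
theorem I4_P01 (q : EuclideanSpace ℝ (Fin 4)) : I4 (P01 q) = P01 (I4 q) := by
  ext i
  fin_cases i <;> simp [P01_apply, I4_apply]

/-- `P01 e₀ ≠ 0` for `e₀ = (1, 0, 0, 0)`. [folklore] -/
theorem P01_single_ne_zero : P01 (EuclideanSpace.single (0 : Fin 4) (1 : ℝ)) ≠ 0 := by
  intro h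
  have h0 := congrArg (fun q : EuclideanSpace ℝ (Fin 4) => q 0) h
  simp [P01_apply] at h0

include hlam hD hη hhol in
/-- **The clause at an axis point, with `β = 1`.** If `λ ∘ η = η` on the axis plane `P01 (ℝ⁴)`
of a holomorphic chart `η` with `0 ∈ D`, then at `h₀ = η (P01 0)` the vector `v = dη (P01 e₀)`
satisfies `dλ v = v ≠ 0` and `dλ (J v) = J v = 0 • dλ v + 1 • J (dλ v)`. [folklore] -/
theorem pos_at_axis (hinj : InjOn η D) (h0 : (0 : EuclideanSpace ℝ (Fin 4)) ∈ D)
    (hret : ∀ q : EuclideanSpace ℝ (Fin 4), lam (η (P01 q)) = η (P01 q)) :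
    ∃ v : TangentSpace (𝓡 4) (η (P01 0)), mfderiv (𝓡 4) (𝓡 4) lam (η (P01 0)) v ≠ 0 ∧
      ∃ α β : ℝ, 0 < β ∧ mfderiv (𝓡 4) (𝓡 4) lam (η (P01 0)) (JX (η (P01 0)) v) =
        α • mfderiv (𝓡 4) (𝓡 4) lam (η (P01 0)) v +
          β • JX (lam (η (P01 0))) (mfderiv (𝓡 4) (𝓡 4) lam (η (P01 0)) v) := by
  have h0' : P01 (0 : EuclideanSpace ℝ (Fin 4)) ∈ D := by rw [map_zero]; exact h0
  obtain ⟨Lam, hLam⟩ : ∃ Lam : EuclideanSpace ℝ (Fin 4) →L[ℝ] EuclideanSpace ℝ (Fin 4),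
      Lam = mfderiv (𝓡 4) (𝓡 4) lam (η (P01 0)) := ⟨_, rfl⟩
  obtain ⟨Φ, hΦ⟩ : ∃ Φ : EuclideanSpace ℝ (Fin 4) →L[ℝ] EuclideanSpace ℝ (Fin 4),
      Φ = mfderiv 𝓘(ℝ, EuclideanSpace ℝ (Fin 4)) (𝓡 4) η (P01 0) := ⟨_, rfl⟩
  obtain ⟨Jy, hJy⟩ : ∃ Jy : EuclideanSpace ℝ (Fin 4) →L[ℝ] EuclideanSpace ℝ (Fin 4),
      Jy = JX (η (P01 0)) := ⟨_, rfl⟩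
  obtain ⟨Jh, hJh⟩ : ∃ Jh : EuclideanSpace ℝ (Fin 4) →L[ℝ] EuclideanSpace ℝ (Fin 4),
      Jh = JX (lam (η (P01 0))) := ⟨_, rfl⟩
  -- differentiate `λ ∘ η ∘ P01 = η ∘ P01` at `0`
  have hηd : MDifferentiableAt 𝓘(ℝ, EuclideanSpace ℝ (Fin 4)) (𝓡 4) η (P01 0) :=
    (contMDiffAt_of_mem hη h0').mdifferentiableAt (by simp)
  have h1 : HasMFDerivAt 𝓘(ℝ, EuclideanSpace ℝ (Fin 4)) (𝓡 4) (η ∘ P01) 0 (Φ.comp P01) := by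
    rw [hΦ]
    exact hηd.hasMFDerivAt.comp 0 P01.hasMFDerivAt
  have h2 : HasMFDerivAt 𝓘(ℝ, EuclideanSpace ℝ (Fin 4)) (𝓡 4) (lam ∘ (η ∘ P01)) 0
      (Lam.comp (Φ.comp P01)) := by
    rw [hLam]
    exact ((hlam _).mdifferentiableAt (by simp)).hasMFDerivAt.comp 0 h1
  have hfun : lam ∘ (η ∘ P01) = η ∘ P01 := funext fun q => hret q
  rw [hfun] at h2
  have hid : Lam.comp (Φ.comp P01) = Φ.comp P01 := hasMFDerivAt_unique h2 h1
  -- the vector `v = dη (P01 e₀)`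
  set e₀ : EuclideanSpace ℝ (Fin 4) := EuclideanSpace.single (0 : Fin 4) (1 : ℝ) with he₀
  have hfix : ∀ q, Lam (Φ (P01 q)) = Φ (P01 q) := fun q =>
    congrArg (fun T : EuclideanSpace ℝ (Fin 4) →L[ℝ] EuclideanSpace ℝ (Fin 4) => T q) hid
  have hv0 : Φ (P01 e₀) ≠ 0 := by
    intro h
    subst hΦ
    exact P01_single_ne_zero (mfderiv_eq_zero hD hη hinj h0' h)
  have hholy : ∀ q, Jy (Φ q) = Φ (I4 q) := by
    subst hJy hΦ
    exact hhol _ h0'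
  have hJh' : Jh = Jy := by
    have key : ∀ x : X, x = η (P01 0) →
        (JX x : EuclideanSpace ℝ (Fin 4) →L[ℝ] EuclideanSpace ℝ (Fin 4)) = Jy := by
      rintro x rfl
      exact hJy.symm
    rw [hJh]
    exact key _ (hret 0)
  have hclause : Lam (Jy (Φ (P01 e₀))) =
      (0 : ℝ) • Lam (Φ (P01 e₀)) + (1 : ℝ) • Jh (Lam (Φ (P01 e₀))) := by
    rw [zero_smul, zero_add, one_smul, hJh', hfix, hholy, I4_P01, hfix]
  have hne : Lam (Φ (P01 e₀)) ≠ 0 := by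
    rw [hfix]
    exact hv0
  refine ⟨Φ (P01 e₀), ?_, 0, 1, one_pos, ?_⟩
  · subst hLam
    exact hne
  · subst hLam hJy hJh
    exact hclause

end PosHolonomy

/-- **Registered helper sub-goal `helper_positiveHolonomyKernelNontrivial`** (third auxiliary file of
stub `stub_positiveHolonomy`): in a flat chart of a `C^∞` map `λ'` (so `λ' = η' ∘ ℓ'` with `ℓ'` valued
in the axis plane), the kernel of `dλ'` is non-trivial at every point of the chart. [folklore] -/
theorem helper_positiveHolonomyKernelNontrivial : ∀ (X : Type) [TopologicalSpace X]
    [ChartedSpace (EuclideanSpace ℝ (Fin 4)) X] (lam' : X → X) (η' : EuclideanSpace ℝ (Fin 4) → X)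
    (D' : Set (EuclideanSpace ℝ (Fin 4))) (N' : Set X), ContMDiff (𝓡 4) (𝓡 4) ∞ lam' → IsOpen D' →
    IsLocalDiffeomorphOn 𝓘(ℝ, EuclideanSpace ℝ (Fin 4)) (𝓡 4) ∞ η' D' → Set.InjOn η' D' → IsOpen N' →
    (∀ y ∈ N', ∃ p ∈ D', p 2 = 0 ∧ p 3 = 0 ∧ η' p = lam' y) →
    ∀ y ∈ N', ∃ v : TangentSpace (𝓡 4) y, v ≠ 0 ∧ mfderiv (𝓡 4) (𝓡 4) lam' y v = 0 :=
  fun _ _ _ _ _ _ _ hlam' hD' hη' hinj' hN' hflat' _ hy =>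
    PosHolonomy.exists_ne_zero_mfderiv_eq_zero hlam' hD' hη' hinj' hN' hflat' hy

end Summit.SmoothPoincare4.SmoothPoincare4.Theorems.GromovRecognitionRelEnd.CrossCapLaurent

end
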